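import Summits.NavierStokesRegularity.NavierStokesRegularity.Theses.HubbleDynamo
import Literature.Analysis.FluidPDE.ParasiticSlabFlow
import HarnessLib

/-!
# Route HubbleDynamo — crux `FarFieldSlaving` (stmt-NavierStokesRegularity-1935): calibration —
  the finite-energy hypotheses are load-bearing (KNSS parasitic flow)

Support file (theorems only, `--supports stmt-NavierStokesRegularity-1935`).

The crux `HubbleDynamo.FarFieldSlaving` reads: for a classical solution on `[0, T)` which is
Leray–Hopf from a rapidly decaying datum and has the Type-I RATE IN TIME
`‖u(t)‖_∞ ≤ C (T − t)^{-1/2}` (`IsTypeIBlowup u T`), every point `x₀` is a space–time Type-I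
centre, `‖u t x‖ ≤ C' / (‖x − x₀‖ + √(T − t))` on `B_δ(x₀) × (T − δ², T)`.

This file records which antecedents any proof must use: WITHOUT the two global hypotheses
`IsLerayHopfOn` (finite energy) and `HasRapidSpatialDecay (u 0)` the statement is FALSE
(`hubbleDynamo_farFieldSlaving_false_without_energy`). The witness is the forward form of the
"parasitic" flow of Koch–Nadirashvili–Seregin–Šverák 2009, §1 (tree:
`Literature.Analysis.FluidPDE.parasiticVelocity` / `parasiticPressure`, time-shifted by `T`):
`u(t, x) = C (T − t)^{-1/2} e₀`, `p(t, x) = −b'(t) ⟨e₀, x⟩`, a spatially constant classical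
solution of Navier–Stokes for EVERY viscosity (`Δu = 0`, `(u·∇)u = 0`) on `[0, T)` which
SATURATES the Type-I rate at every point and is singular at every `(x₀, T)`; at distance `δ/2`
from any `x₀` the claimed bound `C'/(δ/2 + √(T − t))` stays bounded while `‖u‖ = C/√(T − t) → ∞`.

Consequence for the line `registered` of the crux and for crux ideation: the crux (and its stub
`stub_isolatedSingularPoints`: every point of the parasitic flow is singular, so isolation fails
too) is NOT a local statement about the equation plus the rate — local smoothing, ε-regularity at
the rate level and maximum principles on a neighbourhood of `x₀` are all satisfied by the witness;
the energy inequality / decay at spatial infinity (equivalently the pressure normalisation that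
excludes `p = −b'(t)·x`) must enter any proof. In the registered skeleton this is visible: the
vorticity stubs B0/B1 hold trivially for the witness (`curl u = 0`), and it is the landed
kinematic stub B2 (`stub_velocityFromVorticity`, p148017) that consumes `IsLerayHopfOn` to bound
the harmonic remainder.
-/

noncomputable section

-- the problem directory repeats the summit name (D-0017); core's `dupNamespace` linter fires on
-- every declaration of `Summit.NavierStokesRegularity.NavierStokesRegularity.…`
set_option linter.dupNamespace false

namespace Summit.NavierStokesRegularity.NavierStokesRegularity.Theorems

open Set Filter Topology Function MeasureTheory Metric
open scoped InnerProductSpace RealInnerProductSpace ContDiff Laplacian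
open Literature.Analysis Literature.Analysis.FluidPDE
open Summit.NavierStokesRegularity.NavierStokesRegularity.Theses

/-- **The forward parasitic flow is a classical Navier–Stokes solution on `[0, T)` for every
viscosity.** With `u(t, x) = parasiticVelocity C (t − T) x = C (T − t)^{-1/2} e₀` and
`p(t, x) = parasiticPressure C (t − T) x = −b'(t − T) ⟨e₀, x⟩`: both are jointly smooth on
`t < T`, `div u = 0`, `(u·∇)u = 0`, `Δu = 0`, and `∂ₜu = b' e₀ = −∇p` (KNSS 2009, §1 p. 3:
"parasitic solutions `u(x,t) = b(t)`, `p(x,t) = −b'(t)·x`"). [cite: KochNadirashviliSereginSverak2009, §1 (arXiv:0709.3599 p. 3)] -/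
theorem farFieldSlavingParasitic_isClassicalNSSolutionOn (C ν T : ℝ) :
    IsClassicalNSSolutionOn (Set.Ico 0 T) ν 0
      (fun t x => parasiticVelocity C (t - T) x) (fun t x => parasiticPressure C (t - T) x) := by
  -- the shifted time coordinate `(t, x) ↦ t - T` maps `[0, T) × ℝ³` into `t < 0`
  have htime : ContDiffOn ℝ ∞ (fun z : ℝ × EuclideanSpace ℝ (Fin 3) => z.1 - T)
      (Set.Ico (0 : ℝ) T ×ˢ (univ : Set (EuclideanSpace ℝ (Fin 3)))) :=
    contDiffOn_fst.sub contDiffOn_const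
  have hmaps : ∀ z ∈ Set.Ico (0 : ℝ) T ×ˢ (univ : Set (EuclideanSpace ℝ (Fin 3))),
      z.1 - T ∈ Set.Iio (0 : ℝ) := by
    rintro ⟨t, x⟩ ⟨ht, -⟩
    simpa using ht.2
  -- smoothness of `b` and `b'` along the shifted time
  have hamp : ContDiffOn ℝ ∞ (fun z : ℝ × EuclideanSpace ℝ (Fin 3) => parasiticAmp C (z.1 - T))
      (Set.Ico (0 : ℝ) T ×ˢ (univ : Set (EuclideanSpace ℝ (Fin 3)))) :=
    (contDiffOn_parasiticAmp C).comp htime hmaps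
  have hderiv : ContDiffOn ℝ ∞ (deriv (parasiticAmp C)) (Iio 0) :=
    ((contDiffOn_infty_iff_deriv_of_isOpen isOpen_Iio).1 (contDiffOn_parasiticAmp C)).2
  have hderiv' : ContDiffOn ℝ ∞
      (fun z : ℝ × EuclideanSpace ℝ (Fin 3) => deriv (parasiticAmp C) (z.1 - T))
      (Set.Ico (0 : ℝ) T ×ˢ (univ : Set (EuclideanSpace ℝ (Fin 3)))) :=
    hderiv.comp htime hmaps
  refine ⟨?_, ?_, ?_, ?_⟩
  · -- velocity jointly smooth
    show ContDiffOn ℝ ∞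
      (fun z : ℝ × EuclideanSpace ℝ (Fin 3) => parasiticAmp C (z.1 - T) • parasiticDir)
      (Set.Ico (0 : ℝ) T ×ˢ univ)
    exact hamp.smul contDiffOn_const
  · -- pressure jointly smooth
    show ContDiffOn ℝ ∞
      (fun z : ℝ × EuclideanSpace ℝ (Fin 3) =>
        ⟪(-deriv (parasiticAmp C) (z.1 - T)) • parasiticDir, z.2⟫)
      (Set.Ico (0 : ℝ) T ×ˢ univ)
    exact (hderiv'.neg.smul contDiffOn_const).inner ℝ contDiffOn_snd
  · -- momentum equation
    intro t ht x
    have htT : t - T < 0 := by linarith [ht.2]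
    -- the one-sided time derivative within `[0, T)` is the two-sided one
    have hg : HasDerivAt (fun s : ℝ => parasiticVelocity C s x)
        (deriv (parasiticAmp C) (t - T) • parasiticDir) (t - T) :=
      (differentiableAt_parasiticAmp C htT).hasDerivAt.smul_const parasiticDir
    have hg' : HasDerivAt (fun s : ℝ => parasiticVelocity C (s - T) x)
        (deriv (parasiticAmp C) (t - T) • parasiticDir) t :=
      hg.comp_sub_const t T
    have htd : timeDerivWithin (Set.Ico 0 T) (fun t x => parasiticVelocity C (t - T) x) t x =
        deriv (parasiticAmp C) (t - T) • parasiticDir := by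
      rw [timeDerivWithin_apply]
      exact hg'.hasDerivWithinAt.derivWithin (uniqueDiffOn_Ico 0 T t ht)
    rw [htd]
    change deriv (parasiticAmp C) (t - T) • parasiticDir +
        convect (parasiticVelocity C (t - T)) (parasiticVelocity C (t - T)) x =
      ν • (Δ (parasiticVelocity C (t - T))) x - gradient (parasiticPressure C (t - T)) x + 0
    rw [convect_parasiticVelocity, laplacian_parasiticVelocity, gradient_parasiticPressure]
    simp [neg_smul]
  · -- incompressibility
    intro t _
    exact isDivFree_parasiticVelocity C (t - T)

/-- **The forward parasitic flow has the Type-I rate at `T`** (saturated: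
`‖u(t, x)‖ = C/√(T − t)` for `C ≥ 0`). [cite: KochNadirashviliSereginSverak2009, §1 (1.4)] -/
theorem farFieldSlavingParasitic_isTypeIBlowup {C : ℝ} (hC : 0 ≤ C) (T : ℝ) :
    IsTypeIBlowup (fun t x => parasiticVelocity C (t - T) x) T := by
  refine ⟨C, Filter.Eventually.of_forall fun t x => ?_⟩
  change ‖parasiticVelocity C (t - T) x‖ ≤ C / Real.sqrt (T - t)
  rw [norm_parasiticVelocity hC, neg_sub]

/-- **Calibration: `FarFieldSlaving` is FALSE without the finite-energy hypotheses.** Deleting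
`IsLerayHopfOn T ν 0 (u 0) u` and `HasRapidSpatialDecay (u 0)` from the crux
`HubbleDynamo.FarFieldSlaving` (stmt-NavierStokesRegularity-1935) leaves a false statement: the
forward parasitic flow `u = (T − t)^{-1/2} e₀` (`ν = 1`, `T = 1`, `C = 1`) is classical on
`[0, 1)` with the Type-I rate, and at `x₀ = 0`, for any claimed `δ`, `C'`, the point
`x = (δ/2) e₀ ∈ B_δ(0)` and the time `t = 1 − s²`, `s = δ/(4C')`, give
`‖u t x‖ = 4C'/δ > 2C'/δ ≥ C'/(δ/2 + s)`. Hence any proof of the crux (and of the stub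
`stub_isolatedSingularPoints` of line `registered`, which also fails for the witness: every
`(x₀, T)` is singular) must use the energy / decay at infinity; the statement is not local.
[cite: KochNadirashviliSereginSverak2009, §1 (arXiv:0709.3599 p. 3)] -/
theorem hubbleDynamo_farFieldSlaving_false_without_energy :
    ¬ ∀ (ν T : ℝ), 0 < ν → 0 < T →
      ∀ (u : ℝ → EuclideanSpace ℝ (Fin 3) → EuclideanSpace ℝ (Fin 3))
        (p : ℝ → EuclideanSpace ℝ (Fin 3) → ℝ),
        Literature.Analysis.FluidPDE.IsClassicalNSSolutionOn (Set.Ico 0 T) ν 0 u p →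
        Literature.Analysis.FluidPDE.IsTypeIBlowup u T →
        ∀ x₀ : EuclideanSpace ℝ (Fin 3), ∃ δ : ℝ, 0 < δ ∧ ∃ C : ℝ,
          ∀ t ∈ Set.Ioo (T - δ ^ 2) T, ∀ x ∈ Metric.ball x₀ δ,
            ‖u t x‖ ≤ C / (‖x - x₀‖ + Real.sqrt (T - t)) := by
  intro h
  obtain ⟨δ, hδ, C', hC'⟩ := h 1 1 one_pos one_pos _ _
    (farFieldSlavingParasitic_isClassicalNSSolutionOn 1 1 1)
    (farFieldSlavingParasitic_isTypeIBlowup zero_le_one 1) 0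
  -- the test point at distance `δ/2` from `x₀ = 0`
  set x : EuclideanSpace ℝ (Fin 3) := (δ / 2) • parasiticDir with hx_def
  have hxnorm : ‖x - 0‖ = δ / 2 := by
    rw [sub_zero, hx_def, norm_smul, norm_parasiticDir, mul_one, Real.norm_of_nonneg (by linarith)]
  have hxball : x ∈ Metric.ball (0 : EuclideanSpace ℝ (Fin 3)) δ := by
    rw [Metric.mem_ball, dist_eq_norm, hxnorm]
    linarith
  -- the bound along `t = 1 - s²`, `0 < s < δ`: `1/s ≤ C'/(δ/2 + s)`
  have hbound : ∀ s : ℝ, 0 < s → s < δ → 1 / s ≤ C' / (δ / 2 + s) := by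
    intro s hs hsδ
    have ht : (1 : ℝ) - s ^ 2 ∈ Set.Ioo (1 - δ ^ 2) 1 := by
      constructor <;> nlinarith
    have h1 := hC' (1 - s ^ 2) ht x hxball
    have hsq : Real.sqrt (1 - (1 - s ^ 2)) = s := by
      rw [show (1 : ℝ) - (1 - s ^ 2) = s ^ 2 by ring, Real.sqrt_sq hs.le]
    have hnorm : ‖parasiticVelocity 1 (1 - s ^ 2 - 1) x‖ = 1 / s := by
      rw [norm_parasiticVelocity zero_le_one, show -((1 : ℝ) - s ^ 2 - 1) = s ^ 2 by ring,
        Real.sqrt_sq hs.le]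
    change ‖parasiticVelocity 1 (1 - s ^ 2 - 1) x‖ ≤ C' / (‖x - 0‖ + Real.sqrt (1 - (1 - s ^ 2)))
      at h1
    rwa [hnorm, hxnorm, hsq] at h1
  -- `C' ≥ 2 > 0` from `s = δ/2`
  have hC'pos : 0 < C' := by
    have h1 := hbound (δ / 2) (by linarith) (by linarith)
    have hd : (0 : ℝ) < δ / 2 + δ / 2 := by linarith
    rw [div_le_div_iff₀ (by linarith) hd] at h1
    nlinarith
  -- the contradiction at `s = δ/(4C')`
  set s : ℝ := δ / (4 * C') with hs_def
  have hs : 0 < s := by positivity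
  have hsδ : s < δ := by
    rw [hs_def, div_lt_iff₀ (by positivity)]
    have h2 : (2 : ℝ) ≤ C' := by
      have h1 := hbound (δ / 2) (by linarith) (by linarith)
      have hd : (0 : ℝ) < δ / 2 + δ / 2 := by linarith
      rw [div_le_div_iff₀ (by linarith) hd] at h1
      nlinarith
    nlinarith
  have h1 := hbound s hs hsδ
  -- `1/s = 4C'/δ` while `C'/(δ/2 + s) < C'/(δ/2) = 2C'/δ`
  have hlt : C' / (δ / 2 + s) < 1 / s := by
    rw [div_lt_div_iff₀ (by positivity) hs, hs_def]
    field_simp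
    nlinarith [mul_pos hδ hC'pos]
  exact absurd h1 (not_le.2 hlt)

end Summit.NavierStokesRegularity.NavierStokesRegularity.Theorems

end
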